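import Mathlib.Analysis.InnerProductSpace.PiL2
import Mathlib.MeasureTheory.Measure.Lebesgue.EqHaar
import Mathlib.MeasureTheory.Measure.Prod
import Literature.Analysis.FluidPDE.SuitableWeak
import HarnessLib

-- single-conjunct summit (`<Problem> = <Summit>`): the duplicated namespace component is by design
set_option linter.dupNamespace false

/-!
# Route SelfMixingDichotomy — crux `CoherentScaleExclusion` (S2, item stmt-NavierStokesRegularity-1423),
# line `registered`, kinematic witness: lower bound for the scaled cubic load

Support file (`--supports stmt-NavierStokesRegularity-1423`) for the registered stub
`kinWitness_cknC_lowerBound_of_le_norm` of the line `Cruxes/CoherentScaleExclusion/Lines/birth.lean`.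

Write `C(r) = cknC r (T, x₀) u = r⁻² ∫∫_{Q_r(T,x₀)} |u|³` for the CKN scaled cubic load on the
backward parabolic cylinder `Q_r(T, x₀) = (T - r², T) × B_r(x₀)` (`Literature.Analysis.FluidPDE.cknC`,
`…parabolicCylinder`). This file proves the elementary LOWER bound the lead's kinematic witness
needs: if `m ≤ ‖u t x‖` pointwise on a sub-box `R = (a, b) × B_s(c) ⊆ Q_r(T, x₀)`
(`T - r² ≤ a < b ≤ T`, `B_s(c) ⊆ B_r(x₀)`, `0 ≤ m`), then

`ofReal ((b - a) s³ m³ / r²) · |B₁| ≤ C(r)`,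

because `∫∫_{Q_r} |u|³ ≥ ∫∫_{Q_r} m³ 𝟙_R = m³ |R| = m³ (b - a) s³ |B₁|` (`|B_s(c)| = s³ |B₁|` in
`ℝ³`). It is the mirror image of the tree's upper bound
`Literature.Analysis.FluidPDE.SereginSverak2009.cknC_le_of_ae_bound`. Mathlib measure theory only
(`lintegral_mono`, `lintegral_indicator_const`, `Measure.prod_prod`, `Real.volume_Ioo`,
`Measure.addHaar_ball`, `finrank_euclideanSpace_fin`); no named fact is taken as a hypothesis.
-/

noncomputable section

open MeasureTheory Set Metric
open Literature.Analysis.FluidPDE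

namespace Summit.NavierStokesRegularity.NavierStokesRegularity.Theorems

/-- **Volume of a space–time box in `ℝ × ℝ³`.** `|(a, b) × B_s(c)| = (b - a) · s³ · |B₁|` for
`a < b` and `0 ≤ s` (product Lebesgue measure; `Real.volume_Ioo`, `Measure.addHaar_ball`,
`finrank ℝ ℝ³ = 3`). [folklore] -/
theorem kinWitness_cknC_volume_box {a b s : ℝ} (c : EuclideanSpace ℝ (Fin 3)) (hs : 0 ≤ s) :
    volume (Set.Ioo a b ×ˢ Metric.ball c s) =
      ENNReal.ofReal (b - a) *
        (ENNReal.ofReal (s ^ 3) * volume (ball (0 : EuclideanSpace ℝ (Fin 3)) 1)) := by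
  rw [Measure.volume_eq_prod, Measure.prod_prod, Real.volume_Ioo, Measure.addHaar_ball volume c hs,
    finrank_euclideanSpace_fin]

/-- **`ℝ≥0∞` bookkeeping.** For `0 < r`, `0 ≤ m`, `a < b`:
`(ofReal r ^ 2)⁻¹ · (ofReal (m³) · (ofReal (b - a) · (ofReal (s³) · V))) = ofReal ((b - a) s³ m³ / r²) · V`.
[folklore] -/
theorem kinWitness_cknC_ennreal_algebra {r m a b s : ℝ} (hr : 0 < r) (hm : 0 ≤ m) (hab : a < b)
    (V : ENNReal) :
    (ENNReal.ofReal r ^ 2)⁻¹ *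
        (ENNReal.ofReal (m ^ 3) * (ENNReal.ofReal (b - a) * (ENNReal.ofReal (s ^ 3) * V))) =
      ENNReal.ofReal ((b - a) * s ^ 3 * m ^ 3 / r ^ 2) * V := by
  have h1 : (0 : ℝ) ≤ (r ^ 2)⁻¹ := inv_nonneg.2 (pow_pos hr 2).le
  have h2 : (0 : ℝ) ≤ (r ^ 2)⁻¹ * m ^ 3 := mul_nonneg h1 (pow_nonneg hm 3)
  have h3 : (0 : ℝ) ≤ (r ^ 2)⁻¹ * m ^ 3 * (b - a) := mul_nonneg h2 (sub_nonneg.2 hab.le)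
  rw [← ENNReal.ofReal_pow hr.le, ← ENNReal.ofReal_inv_of_pos (pow_pos hr 2), ← mul_assoc,
    ← mul_assoc, ← mul_assoc, ← ENNReal.ofReal_mul h1, ← ENNReal.ofReal_mul h2,
    ← ENNReal.ofReal_mul h3]
  congr 2
  rw [div_eq_mul_inv]
  ring

/-- **Lower bound for the scaled cubic load from a pointwise lower bound on a sub-box.**
If `0 < r`, `T - r² ≤ a < b ≤ T`, `0 < s`, `0 ≤ m`, `B_s(c) ⊆ B_r(x₀)` and `m ≤ ‖u t x‖` for all
`t ∈ (a, b)`, `x ∈ B_s(c)`, then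
`ofReal ((b - a) s³ m³ / r²) · |B₁| ≤ C(r) = cknC r (T, x₀) u`:
the box `R = (a, b) × B_s(c)` lies in `Q_r(T, x₀)`, on it `‖u‖ₑ³ ≥ ofReal (m³)`, so
`∫∫_{Q_r} ‖u‖ₑ³ ≥ ofReal (m³) |R| = ofReal (m³) ofReal (b - a) ofReal (s³) |B₁|`, and the prefactor
`(ofReal r ^ 2)⁻¹` is rearranged by `kinWitness_cknC_ennreal_algebra`. [folklore] -/
theorem kinWitness_cknC_lowerBound_of_le_norm : ∀ (u : ℝ → EuclideanSpace ℝ (Fin 3) → EuclideanSpace ℝ (Fin 3)) (T : ℝ) (x₀ : EuclideanSpace ℝ (Fin 3)) (r : ℝ), 0 < r → ∀ (a b s m : ℝ) (c : EuclideanSpace ℝ (Fin 3)), T - r ^ 2 ≤ a → a < b → b ≤ T → 0 < s → 0 ≤ m → Metric.ball c s ⊆ Metric.ball x₀ r → (∀ t ∈ Set.Ioo a b, ∀ x ∈ Metric.ball c s, m ≤ ‖u t x‖) → ENNReal.ofReal ((b - a) * s ^ 3 * m ^ 3 / r ^ 2) * MeasureTheory.volume (Metric.ball (0 : EuclideanSpace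 ℝ (Fin 3)) 1) ≤ Literature.Analysis.FluidPDE.cknC r ((T, x₀) : ℝ × EuclideanSpace ℝ (Fin 3)) u := by
  intro u T x₀ r hr a b s m c ha hab hb hs hm hball hle
  -- the box `R = (a, b) × B_s(c)` and the cylinder `Q = Q_r(T, x₀)`
  have hR : MeasurableSet (Set.Ioo a b ×ˢ Metric.ball c s) :=
    measurableSet_Ioo.prod measurableSet_ball
  have hsub : Set.Ioo a b ×ˢ Metric.ball c s ⊆
      parabolicCylinder r ((T, x₀) : ℝ × EuclideanSpace ℝ (Fin 3)) :=
    prod_mono (Ioo_subset_Ioo ha hb) hball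
  -- `∫∫_Q m³ 𝟙_R ≤ ∫∫_Q ‖u‖ₑ³`, pointwise
  have hint : ∫⁻ q in parabolicCylinder r ((T, x₀) : ℝ × EuclideanSpace ℝ (Fin 3)),
        (Set.Ioo a b ×ˢ Metric.ball c s).indicator (fun _ => ENNReal.ofReal (m ^ 3)) q ≤
      ∫⁻ q in parabolicCylinder r ((T, x₀) : ℝ × EuclideanSpace ℝ (Fin 3)),
        ‖u q.1 q.2‖ₑ ^ (3 : ℕ) := by
    refine lintegral_mono fun q => ?_
    by_cases hq : q ∈ Set.Ioo a b ×ˢ Metric.ball c s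
    · rw [indicator_of_mem hq, ← ofReal_norm, ← ENNReal.ofReal_pow (norm_nonneg _)]
      exact ENNReal.ofReal_le_ofReal (pow_le_pow_left₀ hm (hle q.1 hq.1 q.2 hq.2) 3)
    · rw [indicator_of_notMem hq]
      exact zero_le
  -- `∫∫_Q m³ 𝟙_R = m³ |R ∩ Q| = m³ |R| = m³ (b - a) s³ |B₁|`
  rw [lintegral_indicator_const hR, Measure.restrict_apply hR, inter_eq_left.2 hsub,
    kinWitness_cknC_volume_box c hs.le] at hint
  rw [← kinWitness_cknC_ennreal_algebra hr hm hab]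
  unfold cknC
  exact mul_le_mul' le_rfl hint

end Summit.NavierStokesRegularity.NavierStokesRegularity.Theorems
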